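import Literature.NumberTheory.LFunctions.WeilResolventVector
import HarnessLib

/-!
# Odd-sector ground states of the truncated Weil quadratic form (operator-free encoding)

Odd-sector twin of `Literature/NumberTheory/LFunctions/WeilGroundState.lean` (same normalisation:
additive variable `t = log x`, test functions `IsWeilTest g`, `Q(g) = weilQuadratic g = W(g ⋆ g̃)`,
`ĝ(s) = weilMellin g s = ∫ g(t) e^{(s-1/2)t} dt`, full ground energy
`ε(a) = weilGroundEnergy a`).

## What is defined

* `weilOddGroundEnergy a = ε_od(a) := inf {Re Q(g) : g test, tsupport g ⊆ [-a, a], g(-t) = -g(t),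
  ∫ |g|² = 1}`, the bottom of Weil's form on the ODD SECTOR of the window `[-a, a]`.
* `IsWeilOddGroundState a u`: `u : ℝ → ℂ` is an ODD-SECTOR GROUND STATE of Weil's quadratic form
  on the window, encoded WITHOUT positing an operator (as `IsWeilGroundState` is): `u ∈ L²` and `u`
  is the `L²`-limit of an `L²`-normalised MINIMISING SEQUENCE OF ODD TEST FUNCTIONS on the window
  — odd window tests `gₙ` (`gₙ(-t) = -gₙ(t)`, `tsupport gₙ ⊆ [-a, a]`, `∫ |gₙ|² = 1`) which are
  minimising IN THE ODD SECTOR, stated junk-free ("for every normalised odd window test `h` and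
  every `δ > 0`, eventually `Re Q(gₙ) ≤ Re Q(h) + δ`"), with `∫ |gₙ − u|² → 0`. This is, token
  for token, the predicate inlined by the route statements `OddOneSignedWindows` / `OddBartaFloor`
  of `Summits/RiemannHypothesis/RiemannHypothesis/Theses/OddSector.lean` (`isWeilOddGroundState_iff`
  is `Iff.rfl`), and it is EQUIVALENT to the `IsWeilGroundState`-shaped form
  "`Re Q(gₙ) → ε_od(a)`" (`isWeilOddGroundState_iff_tendsto`, proved: the odd sphere is bounded
  below, `bddBelow_weilQuadratic_oddSphere`, and contains every `gₙ`).

## The sources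

* E. Bombieri (2000), §2: for `f` on `(0, ∞)`, `f*(x) = x⁻¹ f(1/x)`, "and say that `f` is even if
  `f = f*` and odd if `f = -f*`". In the additive, `1/2`-symmetric variable of this directory
  (`g(t) = e^{t/2} f(e^t)`, so that `f̃(s) = ĝ(s)` and `‖f‖_{L²(dx)} = ‖g‖_{L²(dt)}`) one has
  `(f*)♮(t) = e^{t/2} e^{-t} f(e^{-t}) = g(-t)`: Bombieri's odd functions are exactly `g(-t) = -g(t)`.
* E. Bombieri (2000), §4 Theorem 5: "Let `μ⁺(M)` and `μ⁻(M)` be the infimum of `T[f * f*]` in the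
  class of even and odd functions in `L²([M⁻¹, M])` of norm 1. Then `μ⁺(M)` and `μ⁻(M)` are
  continuous decreasing functions of `M`", whose proof begins "Let `f(x)` be even or odd and a
  minimizer for `T[f * f*]`" — `weilOddGroundEnergy a` is `μ⁻(e^a)` (over the smooth odd functions
  of the window, the form core used throughout this directory, as in `weilGroundEnergy`), and an
  odd-sector ground state is such an odd minimiser; by §4 Problem 2 / Theorem 3 ("Let `{f_ν}` be a
  minimizing sequence … the sequence `{f_ν}` converges to `f` strongly in `L²(E)`") minimisers are
  strong `L²`-limits of normalised minimising sequences, which is the encoding used here and in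
  `IsWeilGroundState`. §9 ("The second eigenvalue problem: even and odd eigenfunctions"),
  Lemma 11: for a symmetric window the eigenvalue problem splits into even and odd eigenfunctions
  `F(-u) = ±F(u)`.
* H. Yoshida (1992) decomposes the space of test functions on `[-a, a]` into its even and odd parts,
  orthogonal for Weil's hermitian form (cited by Bombieri 2000, [5]); not relied on here.

Why the encoding is faithful (functional analysis, for the reviewer; none of it is asserted in
Lean): the reflection `(Rg)(t) = g(-t)` preserves the window, the `L²` norm and `Q`, so the closed
lower-bounded form `Q̄` of the window commutes with `R` and its Friedrichs operator is reduced by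
`L² = L²_even ⊕ L²_odd`; the odd window tests are a form core of the odd part, so `ε_od(a)` is the
bottom of the spectrum of the odd part and the `L²`-limits `u` of normalised odd minimising
sequences are exactly its normalised bottom eigenvectors (`‖u‖₂ = 1`, `Q̄(u) = ε_od(a)`, `u` odd).
The predicate asserts neither existence (Bombieri's Thm 3 restricted to the odd sector) nor
uniqueness.

## API (all proved)

`isWeilOddGroundState_iff` (the inline form of the route statements, `Iff.rfl`),
`isWeilOddGroundState_iff_tendsto` / `.exists_tendsto` / `.of_tendsto` (equivalence with the
`Re Q(gₙ) → ε_od(a)` form), `bddBelow_weilQuadratic_oddSphere`, `weilOddGroundEnergy_le`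
(`ε_od(a) ≤ Re Q(h)` on the odd sphere), `weilGroundEnergy_le_weilOddGroundEnergy` (`ε ≤ ε_od`),
`weilOddGroundEnergy_antitone` (Bombieri Thm 5, "decreasing"), `weilOddGroundEnergy_of_nonpos`
(junk value `0` on a degenerate window), non-vacuity of the hypotheses `exists_isWeilTest_odd_sphere`
and `exists_weilOddMinimizingSeq` (normalised odd minimising sequences exist for every `a > 0`);
and for `h : IsWeilOddGroundState a u`: `.memLp`, `.integral_norm_sq` (`∫ |u|² = 1`),
`.eLpNorm_eq_one`, `.ne_zero`, `.pos` (`0 < a`), `.ae_neg` (`u(-t) = -u(t)` a.e. — ODDNESS PASSES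
TO THE LIMIT), `.ae_eq_zero_of_notMem`, `.ae_eq_indicator`, `.integrableOn`, `.integrable`,
`.integrable_mul_continuous`, `.integrable_mul_cexp`, `.hasDerivAt_weilMellin`,
`.differentiable_weilMellin` (`û` is entire), `.weilMellin_one_sub` (`û(1 - s) = -û(s)`),
`.weilMellin_one_half` (`û(1/2) = 0`), `.integral_eq_zero` (`∫ u = 0`), `.const_mul` / `.smul`
(phases `|c| = 1`), `.congr_ae`. NOT proved: existence `∃ u, IsWeilOddGroundState a u`.

## References

* E. Bombieri, *Remarks on Weil's quadratic functional in the theory of prime numbers I*, Rend.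
  Mat. Acc. Lincei (9) 11 (2000), 183–233: §2 (even/odd), §4 Problem 2, Theorem 3, Theorem 5,
  §9 Lemma 11.
* H. Yoshida, *On Hermitian forms attached to zeta functions*, in: Zeta Functions in Geometry,
  Adv. Stud. Pure Math. 21 (1992), 281–325.
-/

noncomputable section

open Complex Filter Set MeasureTheory
open scoped Real Topology ENNReal ComplexConjugate

namespace Literature.NumberTheory.LFunctions

/-! ## The definitions -/

/-- **The odd-sector ground energy** `ε_od(a) := inf {Re Q(g) : g smooth, tsupport g ⊆ [-a, a],
g(-t) = -g(t), ∫ |g|² = 1}`: Bombieri's `μ⁻(M)`, `M = e^a`, "the infimum of `T[f * f*]` in the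
class of … odd functions in `L²([M⁻¹, M])` of norm 1" (odd: `f = -f*`, `f*(x) = x⁻¹ f(1/x)`, §2,
i.e. `g(-t) = -g(t)` additively), taken over the smooth odd functions of the window as in
`weilGroundEnergy`. DEFINITION ONLY: a real `sInf` (junk value `0` on the empty set, i.e. for
`a ≤ 0`, `weilOddGroundEnergy_of_nonpos`; the set is bounded below,
`bddBelow_weilQuadratic_oddSphere`). [cite: Bombieri2000Weil, §4 Thm 5 and §2] -/
def weilOddGroundEnergy (a : ℝ) : ℝ :=
  sInf {x : ℝ | ∃ g : ℝ → ℂ, IsWeilTest g ∧ tsupport g ⊆ Icc (-a) a ∧ (∀ t, g (-t) = -g t) ∧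
    ∫ t : ℝ, ‖g t‖ ^ 2 = 1 ∧ x = (weilQuadratic g).re}

/-- **Odd-sector ground state of the truncated Weil form, operator-free.**
`IsWeilOddGroundState a u` says that `u : ℝ → ℂ` is square integrable and is the `L²`-limit of an
`L²`-normalised sequence of ODD test functions on the window `[-a, a]` which is minimising in the
odd sector: there are smooth compactly supported `gₙ` with `tsupport gₙ ⊆ [-a, a]`,
`gₙ(-t) = -gₙ(t)`, `∫ |gₙ|² = 1`, such that for every normalised odd window test `h` and every
`δ > 0` eventually `Re Q(gₙ) ≤ Re Q(h) + δ` (equivalently `Re Q(gₙ) → ε_od(a)`,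
`isWeilOddGroundState_iff_tendsto`), and `∫ |gₙ − u|² → 0`. This is an odd minimiser of
Bombieri's Problem 2 on `E = [e^{-a}, e^{a}]` — "Let `f(x)` be … odd and a minimizer for
`T[f * f*]`" (proof of Thm 5, value `μ⁻(e^a)`) — encoded, as in `IsWeilGroundState`, through
Thm 3's strongly `L²`-convergent minimising sequences; equivalently a normalised bottom
eigenfunction of the odd part (`F(-u) = -F(u)`, §9 Lemma 11) of the form on the symmetric window.
Existence is NOT part of the predicate. This is literally the predicate inlined by the route
statements `OddOneSignedWindows` / `OddBartaFloor` (`isWeilOddGroundState_iff`).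
[cite: Bombieri2000Weil, §4 Problem 2, Thm 3, Thm 5; §9 Lemma 11] -/
def IsWeilOddGroundState (a : ℝ) (u : ℝ → ℂ) : Prop :=
  MemLp u 2 ∧ ∃ g : ℕ → ℝ → ℂ,
    (∀ n, IsWeilTest (g n) ∧ tsupport (g n) ⊆ Icc (-a) a ∧ (∀ t, g n (-t) = -g n t) ∧
      ∫ t, ‖g n t‖ ^ 2 = (1 : ℝ)) ∧
    (∀ h : ℝ → ℂ, IsWeilTest h → tsupport h ⊆ Icc (-a) a → (∀ t, h (-t) = -h t) →
      ∫ t, ‖h t‖ ^ 2 = (1 : ℝ) → ∀ δ : ℝ, 0 < δ →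
        ∀ᶠ n in atTop, (weilQuadratic (g n)).re ≤ (weilQuadratic h).re + δ) ∧
    Tendsto (fun n ↦ ∫ t, ‖g n t - u t‖ ^ 2) atTop (𝓝 0)

/-- Unfolding: `IsWeilOddGroundState a u` is literally the inline predicate
`MemLp u 2 ∧ ∃ g, …` of the route statements `OddOneSignedWindows` / `OddBartaFloor`. [folklore] -/
theorem isWeilOddGroundState_iff (a : ℝ) (u : ℝ → ℂ) :
    IsWeilOddGroundState a u ↔
      MemLp u 2 ∧ ∃ g : ℕ → ℝ → ℂ,
        (∀ n, IsWeilTest (g n) ∧ tsupport (g n) ⊆ Icc (-a) a ∧ (∀ t, g n (-t) = -g n t) ∧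
          ∫ t, ‖g n t‖ ^ 2 = (1 : ℝ)) ∧
        (∀ h : ℝ → ℂ, IsWeilTest h → tsupport h ⊆ Icc (-a) a → (∀ t, h (-t) = -h t) →
          ∫ t, ‖h t‖ ^ 2 = (1 : ℝ) → ∀ δ : ℝ, 0 < δ →
            ∀ᶠ n in atTop, (weilQuadratic (g n)).re ≤ (weilQuadratic h).re + δ) ∧
        Tendsto (fun n ↦ ∫ t, ‖g n t - u t‖ ^ 2) atTop (𝓝 0) :=
  Iff.rfl

/-! ## The odd sphere: bounded below, nonempty for `a > 0`, empty for `a ≤ 0` -/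

/-- The values `Re Q(g)` on the odd unit sphere of the window are bounded below (it is a subset of
the full unit sphere, bounded below by `bddBelow_weilQuadratic_sphere_holds`, Bombieri 2000 §4).
[cite: Bombieri2000Weil, §4 Thm 3 (proof: "the functional is bounded below in L²(E)")] -/
theorem bddBelow_weilQuadratic_oddSphere (a : ℝ) :
    BddBelow {x : ℝ | ∃ g : ℝ → ℂ, IsWeilTest g ∧ tsupport g ⊆ Icc (-a) a ∧
      (∀ t, g (-t) = -g t) ∧ ∫ t : ℝ, ‖g t‖ ^ 2 = 1 ∧ x = (weilQuadratic g).re} := by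
  refine (bddBelow_weilQuadratic_sphere_holds a).mono ?_
  rintro x ⟨g, hg, hsupp, -, hnorm, hx⟩
  exact ⟨g, hg, hsupp, hnorm, hx⟩

/-- `ε_od(a) ≤ Re Q(h)` for every normalised odd test function `h` on the window. [folklore] -/
theorem weilOddGroundEnergy_le {a : ℝ} {h : ℝ → ℂ} (hh : IsWeilTest h)
    (hsupp : tsupport h ⊆ Icc (-a) a) (hodd : ∀ t, h (-t) = -h t)
    (hnorm : ∫ t, ‖h t‖ ^ 2 = (1 : ℝ)) :
    weilOddGroundEnergy a ≤ (weilQuadratic h).re :=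
  csInf_le (bddBelow_weilQuadratic_oddSphere a) ⟨h, hh, hsupp, hodd, hnorm, rfl⟩

/-- Test functions form a vector space: differences. [folklore] -/
theorem IsWeilTest.sub' {g h : ℝ → ℂ} (hg : IsWeilTest g) (hh : IsWeilTest h) :
    IsWeilTest fun t ↦ g t - h t :=
  ⟨hg.1.sub hh.1, hg.2.sub hh.2⟩

/-- **The odd unit sphere of a window is nonempty**: for `a > 0` there is an odd test function `g`
with `tsupport g ⊆ [-a, a]` and `∫ |g|² = 1` (antisymmetrise Mathlib's smooth bump centred at
`a/2` with outer radius `a/2`, which equals `1` at `a/2` and vanishes at `-a/2`, and normalise).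
[folklore] -/
theorem exists_isWeilTest_odd_sphere {a : ℝ} (ha : 0 < a) :
    ∃ g : ℝ → ℂ, IsWeilTest g ∧ tsupport g ⊆ Icc (-a) a ∧ (∀ t, g (-t) = -g t) ∧
      ∫ t, ‖g t‖ ^ 2 = (1 : ℝ) := by
  let b : ContDiffBump (a / 2 : ℝ) := ⟨a / 4, a / 2, by positivity, by linarith⟩
  have hbt : IsWeilTest fun t ↦ ((b t : ℝ) : ℂ) :=
    ⟨Complex.ofRealCLM.contDiff.comp b.contDiff,
      b.hasCompactSupport.comp_left Complex.ofReal_zero⟩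
  set g₁ : ℝ → ℂ := fun t ↦ ((b t : ℝ) : ℂ) - ((b (-t) : ℝ) : ℂ) with hg₁
  have hg₁t : IsWeilTest g₁ := hbt.sub' hbt.comp_neg
  have hodd₁ : ∀ t, g₁ (-t) = -g₁ t := fun t ↦ by
    simp only [hg₁, neg_neg, neg_sub]
  -- `b` vanishes off `(0, a)`, so `g₁` vanishes off `[-a, a]`
  have hb0 : ∀ t : ℝ, t ∉ Icc (-a) a → b t = 0 := fun t ht ↦ by
    refine b.zero_of_le_dist ?_
    rw [Real.dist_eq]
    change a / 2 ≤ _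
    rcases not_and_or.1 (by simpa only [mem_Icc] using ht) with h1 | h1
    · rw [abs_of_neg (by linarith)]; linarith
    · rw [abs_of_pos (by linarith)]; linarith
  have hsupp₁ : tsupport g₁ ⊆ Icc (-a) a := by
    refine closure_minimal (fun t ht ↦ ?_) isClosed_Icc
    by_contra hta
    have hta' : -t ∉ Icc (-a) a := fun h' ↦ hta (by
      simp only [mem_Icc] at h' ⊢; constructor <;> linarith [h'.1, h'.2])
    exact ht (by simp only [hg₁, hb0 t hta, hb0 (-t) hta', sub_self])
  -- `g₁ (a/2) = 1`, so `∫ |g₁|² > 0`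
  have hnn : 0 ≤ ∫ t, ‖g₁ t‖ ^ 2 := integral_nonneg fun _ ↦ by positivity
  have hN : 0 < ∫ t, ‖g₁ t‖ ^ 2 := by
    rcases hnn.eq_or_lt with hz | hpos
    · exfalso
      have h0 : g₁ = 0 := hg₁t.eq_zero_of_integral_norm_sq_eq_zero hz.symm
      have h1 : g₁ (a / 2) = 1 := by
        have hb1 : b (a / 2) = 1 :=
          b.one_of_mem_closedBall (Metric.mem_closedBall_self (by positivity))
        have hb2 : b (-(a / 2)) = 0 := by
          refine b.zero_of_le_dist ?_
          rw [Real.dist_eq, abs_of_neg (by linarith)]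
          change a / 2 ≤ _
          linarith
        simp [hg₁, hb1, hb2]
      rw [h0] at h1
      simp at h1
    · exact hpos
  set N : ℝ := ∫ t, ‖g₁ t‖ ^ 2 with hN'
  set c : ℝ := (Real.sqrt N)⁻¹ with hc
  have hcpos : 0 < c := inv_pos.2 (Real.sqrt_pos.2 hN)
  refine ⟨fun t ↦ (c : ℂ) * g₁ t, hg₁t.const_mul c, tsupport_mul_subset_right.trans hsupp₁,
    fun t ↦ by beta_reduce; rw [hodd₁ t, mul_neg], ?_⟩
  simp only [norm_mul, mul_pow, Complex.norm_real, Real.norm_of_nonneg hcpos.le]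
  rw [integral_const_mul, hc, inv_pow, Real.sq_sqrt hnn, inv_mul_cancel₀ hN.ne']

/-- On a degenerate window `a ≤ 0` the odd sphere is empty (the only window test function is `0`,
`IsWeilTest.eq_zero_of_tsupport_subset`), so `ε_od(a)` takes the junk value `sInf ∅ = 0`.
[folklore] -/
theorem weilOddGroundEnergy_of_nonpos {a : ℝ} (ha : a ≤ 0) : weilOddGroundEnergy a = 0 := by
  unfold weilOddGroundEnergy
  convert Real.sInf_empty
  refine Set.eq_empty_of_forall_notMem fun x ↦ ?_
  rintro ⟨g, hg, hsupp, -, hnorm, -⟩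
  have h0 : g = 0 := hg.eq_zero_of_tsupport_subset hsupp ha
  simp [h0] at hnorm

/-- Likewise `ε(a) = weilGroundEnergy a` takes the junk value `0` for `a ≤ 0`. [folklore] -/
theorem weilGroundEnergy_of_nonpos {a : ℝ} (ha : a ≤ 0) : weilGroundEnergy a = 0 := by
  unfold weilGroundEnergy
  convert Real.sInf_empty
  refine Set.eq_empty_of_forall_notMem fun x ↦ ?_
  rintro ⟨g, hg, hsupp, hnorm, -⟩
  have h0 : g = 0 := hg.eq_zero_of_tsupport_subset hsupp ha
  simp [h0] at hnorm

/-- **The odd bottom lies above the bottom**: `ε(a) ≤ ε_od(a)` (the odd sphere is a subset of the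
sphere; for `a ≤ 0` both are the junk value `0`). [folklore] -/
theorem weilGroundEnergy_le_weilOddGroundEnergy (a : ℝ) :
    weilGroundEnergy a ≤ weilOddGroundEnergy a := by
  rcases le_or_gt a 0 with ha | ha
  · rw [weilGroundEnergy_of_nonpos ha, weilOddGroundEnergy_of_nonpos ha]
  · obtain ⟨g, hg, hsupp, hodd, hnorm⟩ := exists_isWeilTest_odd_sphere ha
    exact csInf_le_csInf (bddBelow_weilQuadratic_sphere_holds a) ⟨_, g, hg, hsupp, hodd, hnorm, rfl⟩
      fun x ⟨k, hk, hsuppk, _, hnormk, hx⟩ ↦ ⟨k, hk, hsuppk, hnormk, hx⟩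

/-- **`ε_od` is non-increasing in the window** (Bombieri 2000 Thm 5: "`μ⁻(M)` … decreasing
functions of `M`"): for `0 < b ≤ a` the odd sphere of `[-b, b]` is contained in that of `[-a, a]`.
[cite: Bombieri2000Weil, §4 Thm 5] -/
theorem weilOddGroundEnergy_antitone {a b : ℝ} (hb : 0 < b) (hba : b ≤ a) :
    weilOddGroundEnergy a ≤ weilOddGroundEnergy b := by
  obtain ⟨g, hg, hsupp, hodd, hnorm⟩ := exists_isWeilTest_odd_sphere hb
  exact csInf_le_csInf (bddBelow_weilQuadratic_oddSphere a) ⟨_, g, hg, hsupp, hodd, hnorm, rfl⟩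
    fun x ⟨k, hk, hsuppk, hoddk, hnormk, hx⟩ ↦
      ⟨k, hk, hsuppk.trans (Icc_subset_Icc (by linarith) hba), hoddk, hnormk, hx⟩

/-! ## Minimising in the odd sector: the junk-free clause versus `Re Q(gₙ) → ε_od(a)` -/

/-- **The two forms of "minimising in the odd sector" agree.** For a sequence `gₙ` on the odd unit
sphere of the window, "for every normalised odd window test `h` and `δ > 0`, eventually
`Re Q(gₙ) ≤ Re Q(h) + δ`" holds iff `Re Q(gₙ) → ε_od(a)`: the odd sphere is bounded below and
contains every `gₙ`, so `ε_od(a) ≤ Re Q(gₙ)` always, while competitors `h` with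
`Re Q(h) < ε_od(a) + δ` exist (`exists_lt_of_csInf_lt`). [folklore] -/
theorem forall_eventually_le_iff_tendsto_weilOddGroundEnergy {a : ℝ} {g : ℕ → ℝ → ℂ}
    (hg : ∀ n, IsWeilTest (g n) ∧ tsupport (g n) ⊆ Icc (-a) a ∧ (∀ t, g n (-t) = -g n t) ∧
      ∫ t, ‖g n t‖ ^ 2 = (1 : ℝ)) :
    (∀ h : ℝ → ℂ, IsWeilTest h → tsupport h ⊆ Icc (-a) a → (∀ t, h (-t) = -h t) →
      ∫ t, ‖h t‖ ^ 2 = (1 : ℝ) → ∀ δ : ℝ, 0 < δ →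
        ∀ᶠ n in atTop, (weilQuadratic (g n)).re ≤ (weilQuadratic h).re + δ) ↔
    Tendsto (fun n ↦ (weilQuadratic (g n)).re) atTop (𝓝 (weilOddGroundEnergy a)) := by
  set S : Set ℝ := {x : ℝ | ∃ g : ℝ → ℂ, IsWeilTest g ∧ tsupport g ⊆ Icc (-a) a ∧
    (∀ t, g (-t) = -g t) ∧ ∫ t : ℝ, ‖g t‖ ^ 2 = 1 ∧ x = (weilQuadratic g).re} with hSdef
  have hS : BddBelow S := bddBelow_weilQuadratic_oddSphere a
  have hε : weilOddGroundEnergy a = sInf S := rfl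
  have hmem : ∀ n, (weilQuadratic (g n)).re ∈ S := fun n ↦
    ⟨g n, (hg n).1, (hg n).2.1, (hg n).2.2.1, (hg n).2.2.2, rfl⟩
  have hne : S.Nonempty := ⟨_, hmem 0⟩
  have hlow : ∀ n, weilOddGroundEnergy a ≤ (weilQuadratic (g n)).re := fun n ↦
    hε ▸ csInf_le hS (hmem n)
  constructor
  · intro H
    rw [tendsto_order]
    refine ⟨fun x hx ↦ Eventually.of_forall fun n ↦ hx.trans_le (hlow n), fun x hx ↦ ?_⟩
    have hδ : 0 < (x - weilOddGroundEnergy a) / 2 := by linarith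
    have hlt : sInf S < weilOddGroundEnergy a + (x - weilOddGroundEnergy a) / 2 := by
      rw [← hε]; linarith
    obtain ⟨y, ⟨h, hh, hsupp, hodd, hnorm, rfl⟩, hy⟩ := exists_lt_of_csInf_lt hne hlt
    filter_upwards [H h hh hsupp hodd hnorm _ hδ] with n hn
    linarith
  · intro H h hh hsupp hodd hnorm δ hδ
    have hle : weilOddGroundEnergy a ≤ (weilQuadratic h).re :=
      weilOddGroundEnergy_le hh hsupp hodd hnorm
    have hev : ∀ᶠ n in atTop, (weilQuadratic (g n)).re < weilOddGroundEnergy a + δ :=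
      (tendsto_order.1 H).2 _ (by linarith)
    filter_upwards [hev] with n hn
    linarith

/-- **`IsWeilOddGroundState` in `IsWeilGroundState` shape**: `u ∈ L²` is the `L²`-limit of an
`L²`-normalised sequence of odd window tests with `Re Q(gₙ) → ε_od(a) = weilOddGroundEnergy a`
(the literal odd-sector twin of `isWeilGroundState_iff`). [folklore] -/
theorem isWeilOddGroundState_iff_tendsto (a : ℝ) (u : ℝ → ℂ) :
    IsWeilOddGroundState a u ↔
      MemLp u 2 ∧ ∃ g : ℕ → ℝ → ℂ,
        (∀ n, IsWeilTest (g n) ∧ tsupport (g n) ⊆ Icc (-a) a ∧ (∀ t, g n (-t) = -g n t) ∧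
          ∫ t, ‖g n t‖ ^ 2 = (1 : ℝ)) ∧
        Tendsto (fun n ↦ (weilQuadratic (g n)).re) atTop (𝓝 (weilOddGroundEnergy a)) ∧
        Tendsto (fun n ↦ ∫ t, ‖g n t - u t‖ ^ 2) atTop (𝓝 0) :=
  and_congr_right fun _ ↦ exists_congr fun _ ↦ and_congr_right fun hg ↦
    and_congr_left fun _ ↦ forall_eventually_le_iff_tendsto_weilOddGroundEnergy hg

/-- Constructor from the `Tendsto` form. [folklore] -/
theorem IsWeilOddGroundState.of_tendsto {a : ℝ} {u : ℝ → ℂ} (hu : MemLp u 2) {g : ℕ → ℝ → ℂ}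
    (hg : ∀ n, IsWeilTest (g n) ∧ tsupport (g n) ⊆ Icc (-a) a ∧ (∀ t, g n (-t) = -g n t) ∧
      ∫ t, ‖g n t‖ ^ 2 = (1 : ℝ))
    (hQ : Tendsto (fun n ↦ (weilQuadratic (g n)).re) atTop (𝓝 (weilOddGroundEnergy a)))
    (hlim : Tendsto (fun n ↦ ∫ t, ‖g n t - u t‖ ^ 2) atTop (𝓝 0)) :
    IsWeilOddGroundState a u :=
  (isWeilOddGroundState_iff_tendsto a u).2 ⟨hu, g, hg, hQ, hlim⟩

/-- **Odd minimising sequences exist**: for every window `a > 0` there is an `L²`-normalised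
sequence of odd test functions `gₙ` on `[-a, a]` with `Re Q(gₙ) → ε_od(a)` (the odd sphere is
nonempty, `exists_isWeilTest_odd_sphere`, and bounded below; `exists_seq_tendsto_sInf`). So
`IsWeilOddGroundState a u` asks exactly for the `L²`-CONVERGENCE of such a sequence to `u`
(Bombieri's Thm 3 in the odd sector, not proved here).
[cite: Bombieri2000Weil, §4 Thm 3 (proof, first paragraph) and Thm 5] -/
theorem exists_weilOddMinimizingSeq {a : ℝ} (ha : 0 < a) :
    ∃ g : ℕ → ℝ → ℂ,
      (∀ n, IsWeilTest (g n) ∧ tsupport (g n) ⊆ Icc (-a) a ∧ (∀ t, g n (-t) = -g n t) ∧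
        ∫ t, ‖g n t‖ ^ 2 = (1 : ℝ)) ∧
      Tendsto (fun n ↦ (weilQuadratic (g n)).re) atTop (𝓝 (weilOddGroundEnergy a)) := by
  set S : Set ℝ := {x : ℝ | ∃ g : ℝ → ℂ, IsWeilTest g ∧ tsupport g ⊆ Icc (-a) a ∧
    (∀ t, g (-t) = -g t) ∧ ∫ t : ℝ, ‖g t‖ ^ 2 = 1 ∧ x = (weilQuadratic g).re} with hSdef
  have hne : S.Nonempty := by
    obtain ⟨g, hg, hsupp, hodd, hnorm⟩ := exists_isWeilTest_odd_sphere ha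
    exact ⟨_, g, hg, hsupp, hodd, hnorm, rfl⟩
  have hbdd : BddBelow S := bddBelow_weilQuadratic_oddSphere a
  obtain ⟨x, -, hx, hmem⟩ := exists_seq_tendsto_sInf hne hbdd
  have hmem' : ∀ n, ∃ g : ℝ → ℂ, IsWeilTest g ∧ tsupport g ⊆ Icc (-a) a ∧
      (∀ t, g (-t) = -g t) ∧ ∫ t : ℝ, ‖g t‖ ^ 2 = 1 ∧ x n = (weilQuadratic g).re := hmem
  choose g hg hsupp hodd hnorm hxg using hmem'
  refine ⟨g, fun n ↦ ⟨hg n, hsupp n, hodd n, hnorm n⟩, ?_⟩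
  have hfun : (fun n ↦ (weilQuadratic (g n)).re) = x := funext fun n ↦ (hxg n).symm
  rw [hfun]
  exact hx

/-! ## `L²` bookkeeping for limits of normalised / odd sequences -/

/-- **The `L²`-limit of a normalised sequence is normalised**: `|‖gₙ‖₂ − ‖u‖₂| ≤ ‖gₙ − u‖₂ → 0`
and `‖gₙ‖₂ = 1` (Bombieri 2000, proof of Thm 3: the strong `L²`-limit of the minimising sequence
stays on the unit sphere). [cite: Bombieri2000Weil, §4 Thm 3 (proof)] -/
theorem integral_norm_sq_eq_one_of_tendsto {u : ℝ → ℂ} (hu : MemLp u 2) {g : ℕ → ℝ → ℂ}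
    (hgm : ∀ n, MemLp (g n) 2) (hnorm : ∀ n, ∫ t, ‖g n t‖ ^ 2 = (1 : ℝ))
    (hlim : Tendsto (fun n ↦ ∫ t, ‖g n t - u t‖ ^ 2) atTop (𝓝 0)) :
    ∫ t, ‖u t‖ ^ 2 = 1 := by
  have hsqrt : Tendsto (fun n ↦ Real.sqrt (∫ t, ‖g n t - u t‖ ^ 2)) atTop (𝓝 0) := by
    simpa using hlim.sqrt
  set S : ℝ := Real.sqrt (∫ t, ‖u t‖ ^ 2) with hS
  -- `‖u‖₂ ≤ ‖gₙ‖₂ + ‖gₙ - u‖₂ = 1 + ‖gₙ - u‖₂` and `1 = ‖gₙ‖₂ ≤ ‖u‖₂ + ‖u - gₙ‖₂`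
  have h1 : ∀ n, S ≤ 1 + Real.sqrt (∫ t, ‖g n t - u t‖ ^ 2) := fun n ↦ by
    have := sqrt_integral_norm_sq_sub_le (hgm n) ((hgm n).sub hu)
    simpa only [Pi.sub_apply, sub_sub_cancel, hnorm n, Real.sqrt_one] using this
  have h2 : ∀ n, 1 ≤ S + Real.sqrt (∫ t, ‖g n t - u t‖ ^ 2) := fun n ↦ by
    have := sqrt_integral_norm_sq_sub_le hu (hu.sub (hgm n))
    simpa only [Pi.sub_apply, sub_sub_cancel, hnorm n, Real.sqrt_one, norm_sub_rev (u _)]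
      using this
  have hle : S ≤ 1 :=
    le_of_tendsto_of_tendsto' tendsto_const_nhds
      (by simpa using tendsto_const_nhds.add hsqrt) h1
  have hge : 1 ≤ S :=
    ge_of_tendsto' (by simpa using tendsto_const_nhds.add hsqrt) h2
  exact Real.sqrt_eq_one.1 (le_antisymm hle hge)

/-- **Oddness passes to `L²`-limits**: if odd square-integrable `gₙ` converge to `u ∈ L²` in `L²`,
then `u(-t) = -u(t)` for a.e. `t`. Indeed `u(t) + u(-t) = (u − gₙ)(t) − (gₙ − u)(-t)`, so by
Minkowski and reflection invariance of Lebesgue measure `‖u + u(-·)‖₂ ≤ 2 ‖gₙ − u‖₂ → 0`.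
[folklore] -/
theorem ae_neg_eq_neg_of_tendsto {u : ℝ → ℂ} (hu : MemLp u 2) {g : ℕ → ℝ → ℂ}
    (hgm : ∀ n, MemLp (g n) 2) (hodd : ∀ n t, g n (-t) = -g n t)
    (hlim : Tendsto (fun n ↦ ∫ t, ‖g n t - u t‖ ^ 2) atTop (𝓝 0)) :
    ∀ᵐ t : ℝ, u (-t) = -u t := by
  have hu' : MemLp (fun t ↦ u (-t)) 2 :=
    hu.comp_measurePreserving (Measure.measurePreserving_neg (volume : Measure ℝ))
  have hwm : MemLp (fun t ↦ u t + u (-t)) 2 := hu.add hu'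
  -- the reflected distance equals the distance
  have hrefl : ∀ n, ∫ t, ‖-g n t - u (-t)‖ ^ 2 = ∫ t, ‖g n t - u t‖ ^ 2 := fun n ↦ by
    have h := integral_neg_eq_self (fun t ↦ ‖g n t - u t‖ ^ 2) (volume : Measure ℝ)
    simpa only [hodd n] using h
  have hle : ∀ n, Real.sqrt (∫ t, ‖u t + u (-t)‖ ^ 2) ≤
      2 * Real.sqrt (∫ t, ‖g n t - u t‖ ^ 2) := fun n ↦ by
    have key := sqrt_integral_norm_sq_sub_le (f := fun t ↦ u t - g n t)
      (h := fun t ↦ -g n t - u (-t)) (hu.sub (hgm n)) ((hgm n).neg.sub hu')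
    have e1 : ∀ t, u t - g n t - (-g n t - u (-t)) = u t + u (-t) := fun t ↦ by ring
    simp only [e1, norm_sub_rev (u _) (g n _), hrefl n] at key
    linarith
  have hlim' : Tendsto (fun n ↦ 2 * Real.sqrt (∫ t, ‖g n t - u t‖ ^ 2)) atTop (𝓝 0) := by
    simpa using (hlim.sqrt.const_mul 2)
  have h0 : Real.sqrt (∫ t, ‖u t + u (-t)‖ ^ 2) ≤ 0 := ge_of_tendsto' hlim' hle
  have hI0 : ∫ t, ‖u t + u (-t)‖ ^ 2 = 0 :=
    le_antisymm (Real.sqrt_eq_zero'.1 (le_antisymm h0 (Real.sqrt_nonneg _)))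
      (integral_nonneg fun _ ↦ by positivity)
  have hw2 : Integrable (fun t ↦ ‖u t + u (-t)‖ ^ 2) :=
    (memLp_two_iff_integrable_sq_norm hwm.1).1 hwm
  have hae : (fun t ↦ ‖u t + u (-t)‖ ^ 2) =ᵐ[volume] 0 :=
    (integral_eq_zero_iff_of_nonneg (fun _ ↦ by positivity) hw2).1 hI0
  filter_upwards [hae] with t ht
  have ht' : u t + u (-t) = 0 := by simpa using ht
  exact eq_neg_of_add_eq_zero_right ht'

/-! ## API of `IsWeilOddGroundState` -/

namespace IsWeilOddGroundState

variable {a : ℝ} {u v : ℝ → ℂ}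

/-- An odd-sector ground state is square integrable. [folklore] -/
theorem memLp (h : IsWeilOddGroundState a u) : MemLp u 2 :=
  h.1

/-- **The approximating sequence, `Tendsto` form**: odd normalised window tests `gₙ` with
`Re Q(gₙ) → ε_od(a)` and `∫ |gₙ − u|² → 0`. [folklore] -/
theorem exists_tendsto (h : IsWeilOddGroundState a u) :
    ∃ g : ℕ → ℝ → ℂ,
      (∀ n, IsWeilTest (g n) ∧ tsupport (g n) ⊆ Icc (-a) a ∧ (∀ t, g n (-t) = -g n t) ∧
        ∫ t, ‖g n t‖ ^ 2 = (1 : ℝ)) ∧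
      Tendsto (fun n ↦ (weilQuadratic (g n)).re) atTop (𝓝 (weilOddGroundEnergy a)) ∧
      Tendsto (fun n ↦ ∫ t, ‖g n t - u t‖ ^ 2) atTop (𝓝 0) :=
  ((isWeilOddGroundState_iff_tendsto a u).1 h).2

/-- **Normalisation** `∫ |u|² = 1`. [cite: Bombieri2000Weil, §4 Thm 3 (proof) and Thm 5 ("of norm 1")] -/
theorem integral_norm_sq (h : IsWeilOddGroundState a u) : ∫ t, ‖u t‖ ^ 2 = 1 := by
  obtain ⟨hu, g, hg, -, hlim⟩ := h
  exact integral_norm_sq_eq_one_of_tendsto hu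
    (fun n ↦ (hg n).1.1.continuous.memLp_of_hasCompactSupport (hg n).1.2)
    (fun n ↦ (hg n).2.2.2) hlim

/-- `‖u‖_{L²} = 1` in `eLpNorm` form. [folklore] -/
theorem eLpNorm_eq_one (h : IsWeilOddGroundState a u) : eLpNorm u 2 volume = 1 := by
  rw [eLpNorm_two_eq_ofReal_sqrt h.memLp, h.integral_norm_sq, Real.sqrt_one, ENNReal.ofReal_one]

/-- An odd-sector ground state is not the zero function. [folklore] -/
theorem ne_zero (h : IsWeilOddGroundState a u) : u ≠ 0 := by
  intro hu
  have := h.integral_norm_sq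
  simp [hu] at this

/-- **The window is non-degenerate**: `IsWeilOddGroundState a u → 0 < a` (for `a ≤ 0` a window
test function vanishes, `IsWeilTest.eq_zero_of_tsupport_subset`, and cannot have `∫ |g|² = 1`).
[folklore] -/
theorem pos (h : IsWeilOddGroundState a u) : 0 < a := by
  obtain ⟨-, g, hg, -, -⟩ := h
  by_contra ha
  have h0 : g 0 = 0 := (hg 0).1.eq_zero_of_tsupport_subset (hg 0).2.1 (not_lt.1 ha)
  have h1 := (hg 0).2.2.2
  simp [h0] at h1

/-- **Oddness passes to the limit**: an odd-sector ground state satisfies `u(-t) = -u(t)` for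
a.e. `t` (Bombieri 2000 §9 Lemma 11: the odd eigenfunctions satisfy `F(-u) = -F(u)`).
[cite: Bombieri2000Weil, §9 Lemma 11] -/
theorem ae_neg (h : IsWeilOddGroundState a u) : ∀ᵐ t : ℝ, u (-t) = -u t := by
  obtain ⟨hu, g, hg, -, hlim⟩ := h
  exact ae_neg_eq_neg_of_tendsto hu
    (fun n ↦ (hg n).1.1.continuous.memLp_of_hasCompactSupport (hg n).1.2)
    (fun n ↦ (hg n).2.2.1) hlim

/-- `a.e.`-oddness as an `EventuallyEq`: `u ∘ (-·) = -u` a.e. [folklore] -/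
theorem comp_neg_ae_eq_neg (h : IsWeilOddGroundState a u) :
    (fun t ↦ u (-t)) =ᵐ[volume] fun t ↦ -u t :=
  h.ae_neg

/-- **Localisation**: an odd-sector ground state vanishes a.e. off the window `[-a, a]` (it is an
`L²`-limit of functions supported in the window; Bombieri 2000 §4: the minimiser lies in `L²(E)`).
[cite: Bombieri2000Weil, §4 Problem 2 and Thm 3] -/
theorem ae_eq_zero_of_notMem (h : IsWeilOddGroundState a u) :
    ∀ᵐ t : ℝ, t ∉ Icc (-a) a → u t = 0 := by
  obtain ⟨hu, g, hg, -, hlim⟩ := h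
  exact ae_eq_zero_of_tendsto_integral_norm_sq_sub measurableSet_Icc hu
    (fun n ↦ (hg n).1.1.continuous.memLp_of_hasCompactSupport (hg n).1.2)
    (fun n t ht ↦ image_eq_zero_of_notMem_tsupport fun h' ↦ ht ((hg n).2.1 h')) hlim

/-- An odd-sector ground state agrees a.e. with its truncation to the window. [folklore] -/
theorem ae_eq_indicator (h : IsWeilOddGroundState a u) :
    u =ᵐ[volume] (Icc (-a) a).indicator u := by
  filter_upwards [h.ae_eq_zero_of_notMem] with t ht
  by_cases hm : t ∈ Icc (-a) a
  · simp [hm]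
  · simp [hm, ht hm]

/-- An odd-sector ground state is integrable on its window (`L² ⊆ L¹` there). [folklore] -/
theorem integrableOn (h : IsWeilOddGroundState a u) : IntegrableOn u (Icc (-a) a) :=
  (h.memLp.restrict (Icc (-a) a)).integrable one_le_two

/-- An odd-sector ground state is integrable on `ℝ`. [folklore] -/
theorem integrable (h : IsWeilOddGroundState a u) : Integrable u :=
  h.integrableOn.integrable_of_ae_notMem_eq_zero h.ae_eq_zero_of_notMem

/-- `u · w` is integrable for every continuous `w`. [folklore] -/
theorem integrable_mul_continuous (h : IsWeilOddGroundState a u) {w : ℝ → ℂ} (hw : Continuous w) :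
    Integrable fun t ↦ u t * w t :=
  integrable_mul_continuous_of_ae_eq_zero h.integrableOn h.ae_eq_zero_of_notMem hw

/-- **Exponential moments**: `t ↦ u(t) e^{ct}` is integrable for every `c : ℂ` (in particular the
integrand of `weilMellin u s`, every `s`). [folklore] -/
theorem integrable_mul_cexp (h : IsWeilOddGroundState a u) (c : ℂ) :
    Integrable fun t : ℝ ↦ u t * cexp (c * t) :=
  h.integrable_mul_continuous (by fun_prop)

/-- `û` is complex differentiable everywhere, `û'(s) = ∫ u(t) t e^{(s-1/2)t} dt`.
[cite: Bombieri2000Weil, §4 Lemma 4 and Thm 3 (proof)] -/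
theorem hasDerivAt_weilMellin (h : IsWeilOddGroundState a u) (s₀ : ℂ) :
    HasDerivAt (weilMellin u) (∫ t : ℝ, u t * (t * cexp ((s₀ - 1 / 2) * t))) s₀ :=
  hasDerivAt_weilMellin_of_ae_eq_zero h.integrableOn h.ae_eq_zero_of_notMem s₀

/-- **The transform `û = weilMellin u` of an odd-sector ground state is entire.** [folklore] -/
theorem differentiable_weilMellin (h : IsWeilOddGroundState a u) :
    Differentiable ℂ (weilMellin u) :=
  fun s ↦ (h.hasDerivAt_weilMellin s).differentiableAt

/-- **The transform is odd about `1/2`**: `û(1 - s) = -û(s)` (substitute `t ↦ -t`,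
`weilMellin_comp_neg`, and use a.e. oddness; Bombieri's `f̃*(s) = f̃(1 - s)` with `f* = -f`).
[cite: Bombieri2000Weil, §2] -/
theorem weilMellin_one_sub (h : IsWeilOddGroundState a u) (s : ℂ) :
    weilMellin u (1 - s) = -weilMellin u s := by
  rw [← weilMellin_comp_neg u s]
  unfold weilMellin
  rw [← integral_neg]
  refine integral_congr_ae ?_
  filter_upwards [h.ae_neg] with t ht
  rw [ht, neg_mul]

/-- In particular `û(1/2) = 0`. [folklore] -/
theorem weilMellin_one_half (h : IsWeilOddGroundState a u) : weilMellin u (1 / 2) = 0 := by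
  have h1 := h.weilMellin_one_sub (1 / 2)
  rw [show (1 : ℂ) - 1 / 2 = 1 / 2 by norm_num] at h1
  exact add_self_eq_zero.1 (eq_neg_iff_add_eq_zero.1 h1)

/-- An odd-sector ground state has mean zero: `∫ u = û(1/2) = 0`. [folklore] -/
theorem integral_eq_zero (h : IsWeilOddGroundState a u) : ∫ t, u t = 0 := by
  simpa [weilMellin] using h.weilMellin_one_half

/-- **Phase invariance**: if `u` is an odd-sector ground state then so is `c u` for every constant
`|c| = 1` (odd minimising sequence `c gₙ`; `Q(c g) = |c|² Q(g)`, `weilQuadratic_const_mul`).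
[folklore] -/
theorem const_mul (h : IsWeilOddGroundState a u) {c : ℂ} (hc : ‖c‖ = 1) :
    IsWeilOddGroundState a (fun t ↦ c * u t) := by
  obtain ⟨hu, g, hg, hQ, hlim⟩ := h
  have hc2 : (Complex.normSq c : ℂ) = 1 := by
    rw [Complex.normSq_eq_norm_sq, hc]
    simp
  refine ⟨hu.const_mul c, fun n t ↦ c * g n t, fun n ↦ ⟨(hg n).1.const_mul c,
    tsupport_mul_subset_right.trans (hg n).2.1,
    fun t ↦ by beta_reduce; rw [(hg n).2.2.1 t, mul_neg], ?_⟩,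
    ?_, ?_⟩
  · simpa only [norm_mul, mul_pow, hc, one_pow, one_mul] using (hg n).2.2.2
  · intro k hk hsupp hodd hnorm δ hδ
    simpa only [weilQuadratic_const_mul, hc2, one_mul] using hQ k hk hsupp hodd hnorm δ hδ
  · simpa only [← mul_sub, norm_mul, mul_pow, hc, one_pow, one_mul] using hlim

/-- Phase invariance, `•` form: `IsWeilOddGroundState a (c • u)` for `‖c‖ = 1`. [folklore] -/
theorem smul (h : IsWeilOddGroundState a u) {c : ℂ} (hc : ‖c‖ = 1) :
    IsWeilOddGroundState a (c • u) :=
  h.const_mul hc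

/-- In particular `-u` is an odd-sector ground state with `u`. [folklore] -/
theorem neg (h : IsWeilOddGroundState a u) : IsWeilOddGroundState a (fun t ↦ -u t) := by
  simpa using h.const_mul (c := -1) (by simp)

/-- **Invariance under modification on a null set**: the predicate only sees `u` through `MemLp`
and `∫ |gₙ − u|²`. [folklore] -/
theorem congr_ae (h : IsWeilOddGroundState a u) (huv : u =ᵐ[volume] v) :
    IsWeilOddGroundState a v := by
  obtain ⟨hu, g, hg, hQ, hlim⟩ := h
  refine ⟨hu.ae_eq huv, g, hg, hQ, ?_⟩
  have he : ∀ n, ∫ t, ‖g n t - v t‖ ^ 2 = ∫ t, ‖g n t - u t‖ ^ 2 := fun n ↦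
    integral_congr_ae (huv.mono fun t ht ↦ by simp [ht])
  simpa only [he] using hlim

end IsWeilOddGroundState

/-- `IsWeilOddGroundState a` is a property of the a.e.-class of `u`. [folklore] -/
theorem isWeilOddGroundState_congr_ae {a : ℝ} {u v : ℝ → ℂ} (huv : u =ᵐ[volume] v) :
    IsWeilOddGroundState a u ↔ IsWeilOddGroundState a v :=
  ⟨fun h ↦ h.congr_ae huv, fun h ↦ h.congr_ae huv.symm⟩

/-- The zero function is never an odd-sector ground state. [folklore] -/
theorem not_isWeilOddGroundState_zero (a : ℝ) : ¬ IsWeilOddGroundState a 0 :=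
  fun h ↦ h.ne_zero rfl

/-- There are no odd-sector ground states on a degenerate window `a ≤ 0`. [folklore] -/
theorem not_isWeilOddGroundState_of_nonpos {a : ℝ} (ha : a ≤ 0) (u : ℝ → ℂ) :
    ¬ IsWeilOddGroundState a u :=
  fun h ↦ (not_lt.2 ha) h.pos

end Literature.NumberTheory.LFunctions

end
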